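import Mathlib.MeasureTheory.Constructions.HaarToSphere
import Mathlib.MeasureTheory.Integral.Prod
import Mathlib.Analysis.Calculus.ParametricIntegral
import HarnessLib

/-!
# Integration in polar coordinates: sphere integrals

Analysis/FluidPDE support file (serves the §10 enstrophy argument of Tao 2011, Thm. 10.1, whose
heat-flux term `Y₃` is "computed […] in polar coordinates" and bounded by sphere integrals
`∫_{S²} |ω(t, R'(t)α)|² dα`, and whose radius `R'` is then chosen by pigeonholing over
`∫ (∫_{S²} …) dR'` — arXiv:1108.1165 p. 31). For a finite-dimensional real inner product space
`E` with an additive Haar measure `μ` we define the **sphere integral**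

  `sphereIntegral μ f r = ∫ f (r • α) dσ(α)`,  `σ = μ.toSphere` (Mathlib's measure on the unit sphere),

and prove the **polar-coordinates formula**

  `∫ f dμ = ∫_{r > 0} r^{dim E − 1} · sphereIntegral μ f r dr`   (`integral_eq_integral_Ioi_sphereIntegral`)

for integrable `f` (Mathlib's `measurePreserving_homeomorphUnitSphereProd` — the polar
homeomorphism `x ↦ (x/‖x‖, ‖x‖)` pushes `μ` on `E ∖ {0}` to `σ × r^{d−1}dr` — followed by Fubini;
Mathlib itself only records the radial special case `integral_fun_norm_addHaar`).

## References

* T. Tao, arXiv:1108.1165 (`Tao2011`), §10, proof of Thm. 10.1 (p. 31, the term `Y₃` and the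
  choice of `R'`).
* Mathlib, `Mathlib/MeasureTheory/Constructions/HaarToSphere.lean`.
-/

noncomputable section

open MeasureTheory MeasureTheory.Measure Set Function Filter Topology Metric Module
open scoped ENNReal NNReal

namespace Literature.Analysis.FluidPDE

variable {E : Type*} [NormedAddCommGroup E] [NormedSpace ℝ E] [FiniteDimensional ℝ E]
  [MeasurableSpace E] [BorelSpace E]
variable {F : Type*} [NormedAddCommGroup F] [NormedSpace ℝ F]

/-- **The sphere integral** of `f : E → F` at radius `r` with respect to the measure
`σ = μ.toSphere` on the unit sphere induced by `μ`: `∫ f(r α) dσ(α)`. For `μ` = Lebesgue measure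
on `ℝ³`, `σ` is the surface measure on `S²` and `r² · sphereIntegral μ f r` is the surface
integral of `f` over the sphere of radius `r`. [folklore] -/
def sphereIntegral (μ : Measure E) (f : E → F) (r : ℝ) : F :=
  ∫ α, f (r • (α : E)) ∂μ.toSphere

omit [FiniteDimensional ℝ E] [BorelSpace E] in
/-- Unfolding `sphereIntegral`. [folklore] -/
theorem sphereIntegral_def (μ : Measure E) (f : E → F) (r : ℝ) :
    sphereIntegral μ f r = ∫ α, f (r • (α : E)) ∂μ.toSphere := rfl

variable (μ : Measure E) [μ.IsAddHaarMeasure]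

/-- **Polar coordinates.** For `f` integrable with respect to an additive Haar measure `μ` on a
finite-dimensional real normed space of positive dimension,
`∫ f dμ = ∫_{r>0} r^{dim E − 1} · (∫ f(rα) dσ(α)) dr`. [folklore] -/
theorem integral_eq_integral_Ioi_sphereIntegral [Nontrivial E] [CompleteSpace F] {f : E → F}
    (hf : Integrable f μ) :
    ∫ x, f x ∂μ = ∫ r in Ioi (0 : ℝ), (r ^ (finrank ℝ E - 1)) • sphereIntegral μ f r := by
  -- Step 1: remove the origin and pass to the product `sphere × (0, ∞)`
  have h0 : ∫ x, f x ∂μ = ∫ x : ({(0 : E)}ᶜ : Set E), f x.1 ∂(μ.comap (↑)) := by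
    rw [integral_subtype_comap (measurableSet_singleton _).compl fun x => f x,
      restrict_compl_singleton]
  have hmp := μ.measurePreserving_homeomorphUnitSphereProd
  have hemb := (homeomorphUnitSphereProd E).measurableEmbedding
  set g : sphere (0 : E) 1 × Ioi (0 : ℝ) → F := fun q => f (q.2.1 • (q.1 : E)) with hg
  have hcomp : (fun x : ({(0 : E)}ᶜ : Set E) => f x.1) = g ∘ homeomorphUnitSphereProd E := by
    funext x
    simp only [hg, comp_apply]
    congr 1
    have hx := homeomorphUnitSphereProd_symm_apply_coe E (homeomorphUnitSphereProd E x)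
    rw [Homeomorph.symm_apply_apply] at hx
    exact hx
  have h1 : ∫ x : ({(0 : E)}ᶜ : Set E), f x.1 ∂(μ.comap (↑)) =
      ∫ q, g q ∂(μ.toSphere.prod (volumeIoiPow (finrank ℝ E - 1))) := by
    rw [hcomp]
    exact hmp.integral_comp hemb g
  -- integrability on the product
  have hint0 : Integrable (fun x : ({(0 : E)}ᶜ : Set E) => f x.1) (μ.comap (↑)) := by
    have hme := MeasurableEmbedding.subtype_coe (measurableSet_singleton (0 : E)).compl
    change Integrable (f ∘ Subtype.val) _
    rw [← hme.integrable_map_iff, map_comap_subtype_coe (measurableSet_singleton _).compl]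
    exact hf.restrict
  have hintg : Integrable g (μ.toSphere.prod (volumeIoiPow (finrank ℝ E - 1))) := by
    rw [← hmp.integrable_comp_emb hemb, ← hcomp]
    exact hint0
  -- Step 2: Fubini, radius outermost
  have h2 : ∫ q, g q ∂(μ.toSphere.prod (volumeIoiPow (finrank ℝ E - 1))) =
      ∫ r, ∫ α, g (α, r) ∂μ.toSphere ∂(volumeIoiPow (finrank ℝ E - 1)) :=
    integral_prod_symm g hintg
  -- Step 3: the radial measure `r^{d-1} dr`
  have h3 : ∫ r, ∫ α, g (α, r) ∂μ.toSphere ∂(volumeIoiPow (finrank ℝ E - 1)) =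
      ∫ r in Ioi (0 : ℝ), (r ^ (finrank ℝ E - 1)) • sphereIntegral μ f r := by
    simp only [volumeIoiPow, hg, sphereIntegral_def, ENNReal.ofReal]
    rw [integral_withDensity_eq_integral_smul, integral_subtype_comap measurableSet_Ioi
      fun a : ℝ => Real.toNNReal (a ^ (finrank ℝ E - 1)) • ∫ α, f (a • (α : E)) ∂μ.toSphere,
      setIntegral_congr_fun measurableSet_Ioi fun x hx => ?_]
    · rw [NNReal.smul_def, Real.coe_toNNReal _ (pow_nonneg hx.out.le _)]
    · exact (measurable_subtype_coe.pow_const _).real_toNNReal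
  rw [h0, h1, h2, h3]


/-! ## Shells -/

omit [FiniteDimensional ℝ E] [MeasurableSpace E] [BorelSpace E] in
/-- On the unit sphere, `‖r • α‖ = r` for `r ≥ 0`. [folklore] -/
theorem norm_smul_sphere {r : ℝ} (hr : 0 ≤ r) (α : sphere (0 : E) 1) : ‖r • (α : E)‖ = r := by
  rw [norm_smul, norm_eq_of_mem_sphere α, mul_one, Real.norm_eq_abs, abs_of_nonneg hr]

omit [FiniteDimensional ℝ E] [BorelSpace E] [μ.IsAddHaarMeasure] in
/-- The sphere integral of `f · 1_{a < ‖x‖ < b}` at radius `r > 0` is `sphereIntegral μ f r` for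
`a < r < b` and `0` otherwise. [folklore] -/
theorem sphereIntegral_indicator_shell (f : E → F) {a b r : ℝ} (hr : 0 < r) :
    sphereIntegral μ ({x : E | a < ‖x‖ ∧ ‖x‖ < b}.indicator f) r =
      if a < r ∧ r < b then sphereIntegral μ f r else 0 := by
  simp only [sphereIntegral_def]
  by_cases h : a < r ∧ r < b
  · rw [if_pos h]
    refine integral_congr_ae (ae_of_all _ fun α => ?_)
    show {x : E | a < ‖x‖ ∧ ‖x‖ < b}.indicator f (r • (α : E)) = f (r • (α : E))
    rw [indicator_of_mem]
    simpa [mem_setOf_eq, norm_smul_sphere hr.le α] using h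
  · rw [if_neg h]
    rw [← integral_zero (sphere (0 : E) 1) F]
    refine integral_congr_ae (ae_of_all _ fun α => ?_)
    show {x : E | a < ‖x‖ ∧ ‖x‖ < b}.indicator f (r • (α : E)) = 0
    rw [indicator_of_notMem]
    simpa [mem_setOf_eq, norm_smul_sphere hr.le α] using h

omit [NormedSpace ℝ E] [FiniteDimensional ℝ E] in
/-- Shells `{a < ‖x‖ < b}` are measurable. [folklore] -/
theorem measurableSet_shell (a b : ℝ) : MeasurableSet {x : E | a < ‖x‖ ∧ ‖x‖ < b} :=
  (isOpen_lt continuous_const continuous_norm).measurableSet.inter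
    (isOpen_lt continuous_norm continuous_const).measurableSet

/-- **Polar coordinates on a shell.** For `f` integrable on the shell and `0 ≤ a`:
`∫_{a < ‖x‖ < b} f dμ = ∫_{(a, b)} r^{dim E − 1} · (∫ f(rα) dσ(α)) dr`. [folklore] -/
theorem setIntegral_shell_eq_integral_sphereIntegral [Nontrivial E] [CompleteSpace F] {f : E → F}
    {a b : ℝ} (hf : IntegrableOn f {x : E | a < ‖x‖ ∧ ‖x‖ < b} μ) (ha : 0 ≤ a) :
    ∫ x in {x : E | a < ‖x‖ ∧ ‖x‖ < b}, f x ∂μ =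
      ∫ r in Ioo a b, (r ^ (finrank ℝ E - 1)) • sphereIntegral μ f r := by
  have hS : MeasurableSet {x : E | a < ‖x‖ ∧ ‖x‖ < b} := measurableSet_shell a b
  rw [← integral_indicator hS,
    integral_eq_integral_Ioi_sphereIntegral μ (hf.integrable_indicator hS)]
  -- reduce the radial integral over `(0, ∞)` to `(a, b)`
  have hsub : Ioo a b ⊆ Ioi (0 : ℝ) := fun r hr => ha.trans_lt hr.1
  rw [← integral_indicator (measurableSet_Ioo : MeasurableSet (Ioo a b)),
    ← integral_indicator (measurableSet_Ioi : MeasurableSet (Ioi (0 : ℝ)))]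
  refine integral_congr_ae (ae_of_all _ fun r => ?_)
  by_cases hr : r ∈ Ioi (0 : ℝ)
  · rw [indicator_of_mem hr, sphereIntegral_indicator_shell μ f hr]
    by_cases h : a < r ∧ r < b
    · rw [if_pos h, indicator_of_mem (show r ∈ Ioo a b from h)]
    · rw [if_neg h, smul_zero, indicator_of_notMem (show r ∉ Ioo a b from h)]
  · rw [indicator_of_notMem hr, indicator_of_notMem fun h => hr (hsub h)]

/-! ## Continuity and differentiability in the radius -/

omit [BorelSpace E] in
/-- The sphere integral of a continuous function is continuous in the radius. [folklore] -/
theorem continuous_sphereIntegral [BorelSpace E] [CompleteSpace F] {f : E → F} (hf : Continuous f) :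
    Continuous (sphereIntegral μ f) := by
  have hF : Continuous (uncurry fun (r : ℝ) (α : sphere (0 : E) 1) => f (r • (α : E))) :=
    hf.comp (continuous_fst.smul (continuous_subtype_val.comp continuous_snd))
  have h := continuous_parametric_integral_of_continuous (μ := μ.toSphere) hF isCompact_univ
  simp only [Measure.restrict_univ] at h
  exact h

omit [BorelSpace E] in
/-- Continuity in the radius on `(0, ∞)` for an integrand continuous away from the origin. [folklore] -/
theorem continuousOn_sphereIntegral_Ioi [BorelSpace E] [CompleteSpace F] {g : E → F}
    (hg : ContinuousOn g {0}ᶜ) : ContinuousOn (sphereIntegral μ g) (Ioi 0) := by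
  have hF : ContinuousOn (uncurry fun (r : ℝ) (α : sphere (0 : E) 1) => g (r • (α : E)))
      (Ioi (0 : ℝ) ×ˢ univ) := by
    refine hg.comp (continuous_fst.smul (continuous_subtype_val.comp continuous_snd)).continuousOn
      ?_
    rintro ⟨r, α⟩ ⟨hr, -⟩
    simp only [mem_compl_iff, mem_singleton_iff, smul_eq_zero, not_or]
    exact ⟨(mem_Ioi.1 hr).ne', ne_zero_of_mem_unit_sphere α⟩
  exact continuousOn_integral_of_compact_support (μ := μ.toSphere) isCompact_univ hF
    (fun r α _ hα => absurd (mem_univ α) hα)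

/-- **Differentiating the sphere integral in the radius.** For `f ∈ C¹`,
`d/dr ∫ f(rα) dσ(α) = ∫ Df(rα)·α dσ(α)` at every `r` (differentiation under the integral sign
over the finite measure `σ`, dominated by `sup |Df|` on a ball). [folklore] -/
theorem hasDerivAt_sphereIntegral [CompleteSpace F] {f : E → F} (hf : ContDiff ℝ 1 f) (r : ℝ) :
    HasDerivAt (sphereIntegral μ f)
      (∫ α, fderiv ℝ f (r • (α : E)) (α : E) ∂μ.toSphere) r := by
  have hfd : Differentiable ℝ f := hf.differentiable one_ne_zero
  have hfc : Continuous (fderiv ℝ f) := hf.continuous_fderiv one_ne_zero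
  -- a bound for `Df` on the ball of radius `|r| + 1`
  obtain ⟨C, hC⟩ := (isCompact_closedBall (0 : E) (|r| + 1)).exists_bound_of_continuousOn
    hfc.continuousOn
  have hs : Ioo (r - 1) (r + 1) ∈ 𝓝 r := Ioo_mem_nhds (by linarith) (by linarith)
  have hslice : ∀ ρ : ℝ, Continuous fun α : sphere (0 : E) 1 => f (ρ • (α : E)) := fun ρ =>
    hf.continuous.comp (continuous_const.smul continuous_subtype_val)
  have hslice' : ∀ ρ : ℝ, Continuous fun α : sphere (0 : E) 1 => fderiv ℝ f (ρ • (α : E)) (α : E) :=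
    fun ρ => (hfc.comp (continuous_const.smul continuous_subtype_val)).clm_apply
      continuous_subtype_val
  have hint : ∀ ρ : ℝ, Integrable (fun α : sphere (0 : E) 1 => f (ρ • (α : E))) μ.toSphere :=
    fun ρ => (integrableOn_univ.1 ((hslice ρ).continuousOn.integrableOn_compact isCompact_univ))
  refine (hasDerivAt_integral_of_dominated_loc_of_deriv_le (μ := μ.toSphere)
    (F := fun (ρ : ℝ) (α : sphere (0 : E) 1) => f (ρ • (α : E)))
    (F' := fun (ρ : ℝ) (α : sphere (0 : E) 1) => fderiv ℝ f (ρ • (α : E)) (α : E))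
    (bound := fun _ => max C 0) hs
    (Eventually.of_forall fun ρ => (hslice ρ).aestronglyMeasurable) (hint r)
    (hslice' r).aestronglyMeasurable ?_ (integrable_const _) ?_).2
  · refine ae_of_all _ fun α ρ hρ => ?_
    have hmem : ρ • (α : E) ∈ closedBall (0 : E) (|r| + 1) := by
      rw [mem_closedBall, dist_zero_right, norm_smul, norm_eq_of_mem_sphere α, mul_one,
        Real.norm_eq_abs]
      have h1 := hρ.1; have h2 := hρ.2
      rw [abs_le]; constructor <;> [linarith [neg_abs_le r, le_abs_self r]; linarith [le_abs_self r]]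
    calc ‖fderiv ℝ f (ρ • (α : E)) (α : E)‖ ≤ ‖fderiv ℝ f (ρ • (α : E))‖ * ‖(α : E)‖ :=
          ContinuousLinearMap.le_opNorm _ _
      _ ≤ max C 0 * 1 := by
          rw [norm_eq_of_mem_sphere α]
          exact mul_le_mul ((hC _ hmem).trans (le_max_left _ _)) le_rfl zero_le_one
            (le_max_right _ _)
      _ = max C 0 := mul_one _
  · refine ae_of_all _ fun α ρ _ => ?_
    have h1 : HasDerivAt (fun ρ : ℝ => ρ • (α : E)) ((1 : ℝ) • (α : E)) ρ :=
      (hasDerivAt_id ρ).smul_const (α : E)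
    rw [one_smul] at h1
    exact (hfd (ρ • (α : E))).hasFDerivAt.comp_hasDerivAt ρ h1

/-- At radius `r > 0` the derivative of the sphere integral is the sphere integral of the radial
derivative `∂ᵣf(x) = Df(x)(x/‖x‖)`. [folklore] -/
theorem hasDerivAt_sphereIntegral_radial [CompleteSpace F] {f : E → F} (hf : ContDiff ℝ 1 f)
    {r : ℝ} (hr : 0 < r) :
    HasDerivAt (sphereIntegral μ f)
      (sphereIntegral μ (fun x => fderiv ℝ f x (‖x‖⁻¹ • x)) r) r := by
  have h := hasDerivAt_sphereIntegral μ hf r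
  refine h.congr_deriv ?_
  rw [sphereIntegral_def]
  refine integral_congr_ae (ae_of_all _ fun α => ?_)
  simp only
  rw [norm_smul_sphere hr.le α, smul_smul, inv_mul_cancel₀ hr.ne', one_smul]

/-! ## The divergence theorem on shells, radial form -/

omit [FiniteDimensional ℝ E] [MeasurableSpace E] [BorelSpace E] in
/-- The radial derivative field `x ↦ Df(x)(x/‖x‖)` of a `C¹` function is continuous away from
the origin. [folklore] -/
theorem continuousOn_radialDeriv {f : E → F} (hf : ContDiff ℝ 1 f) :
    ContinuousOn (fun x => fderiv ℝ f x (‖x‖⁻¹ • x)) {0}ᶜ := by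
  refine ((hf.continuous_fderiv one_ne_zero).continuousOn).clm_apply ?_
  exact (continuousOn_inv₀.comp continuous_norm.continuousOn fun x hx => by
    simpa using hx).smul continuousOn_id

omit [FiniteDimensional ℝ E] [BorelSpace E] [μ.IsAddHaarMeasure] in
/-- The sphere integral of `‖x‖⁻¹ • f` at radius `r > 0` is `r⁻¹ •` that of `f`. [folklore] -/
theorem sphereIntegral_inv_norm_smul {f : E → F} {r : ℝ} (hr : 0 < r) :
    sphereIntegral μ (fun x => ‖x‖⁻¹ • f x) r = r⁻¹ • sphereIntegral μ f r := by
  rw [sphereIntegral_def, sphereIntegral_def, ← integral_smul]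
  refine integral_congr_ae (ae_of_all _ fun α => ?_)
  simp only [norm_smul_sphere hr.le α]

/-- **The divergence theorem on a shell, radial form.** For `f ∈ C¹(E; F)` and `0 < a ≤ b`,
`∫_{a<‖x‖<b} ∂ᵣf dμ = b^{d−1}·(∫ f(bα)dσ) − a^{d−1}·(∫ f(aα)dσ) − (d−1)∫_{a<‖x‖<b} f/‖x‖ dμ`,
`d = dim E`, `∂ᵣf(x) = Df(x)(x/‖x‖)` (fundamental theorem of calculus for
`r ↦ r^{d−1}∫f(rα)dσ` plus polar coordinates on the shell; on `ℝ³` this is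
`∫_{shell} ∂ᵣf = b²∮_{S_b} f − a²∮_{S_a} f − 2∫_{shell} f/|x|`, the computation behind the sphere
terms of Tao's heat-flux bound `Y₃ ≲ b(t)`). [folklore] -/
theorem setIntegral_shell_radialDeriv_eq [Nontrivial E] [CompleteSpace F] {f : E → F}
    (hf : ContDiff ℝ 1 f) {a b : ℝ} (ha : 0 < a) (hab : a ≤ b) :
    ∫ x in {x : E | a < ‖x‖ ∧ ‖x‖ < b}, fderiv ℝ f x (‖x‖⁻¹ • x) ∂μ =
      (b ^ (finrank ℝ E - 1)) • sphereIntegral μ f b - (a ^ (finrank ℝ E - 1)) • sphereIntegral μ f a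
        - ((finrank ℝ E - 1 : ℕ) : ℝ) • ∫ x in {x : E | a < ‖x‖ ∧ ‖x‖ < b}, ‖x‖⁻¹ • f x ∂μ := by
  set d : ℕ := finrank ℝ E with hd
  have hd1 : 1 ≤ d := Module.finrank_pos
  -- the sphere integrals of `f` and of `∂ᵣf`, as functions of the radius
  set S : ℝ → F := sphereIntegral μ f with hS
  set D : ℝ → F := sphereIntegral μ (fun x => fderiv ℝ f x (‖x‖⁻¹ • x)) with hD
  have hSc : Continuous S := continuous_sphereIntegral μ hf.continuous
  have hDc : ContinuousOn D (Ioi 0) := continuousOn_sphereIntegral_Ioi μ (continuousOn_radialDeriv hf)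
  have hSd : ∀ ρ, 0 < ρ → HasDerivAt S (D ρ) ρ := fun ρ hρ => hasDerivAt_sphereIntegral_radial μ hf hρ
  -- `G ρ = ρ^{d-1} • S ρ` and its derivative
  have hG : ∀ ρ, 0 < ρ → HasDerivAt (fun ρ : ℝ => ρ ^ (d - 1) • S ρ)
      (ρ ^ (d - 1) • D ρ + (((d - 1 : ℕ) : ℝ) * ρ ^ (d - 1 - 1)) • S ρ) ρ := fun ρ hρ =>
    (hasDerivAt_pow (d - 1) ρ).smul (hSd ρ hρ)
  have hcont : ContinuousOn (fun ρ : ℝ => ρ ^ (d - 1) • D ρ + (((d - 1 : ℕ) : ℝ) * ρ ^ (d - 1 - 1)) • S ρ)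
      (Icc a b) :=
    (((continuous_pow _).continuousOn).smul (hDc.mono fun ρ hρ => ha.trans_le hρ.1)).add
      ((continuous_const.mul (continuous_pow _)).continuousOn.smul hSc.continuousOn)
  have hftc := intervalIntegral.integral_eq_sub_of_hasDerivAt
    (fun ρ hρ => hG ρ (ha.trans_le (by rw [uIcc_of_le hab] at hρ; exact hρ.1)))
    (hcont.intervalIntegrable_of_Icc hab)
  -- split the integral of `G'`
  have hi1 : IntervalIntegrable (fun ρ : ℝ => ρ ^ (d - 1) • D ρ) volume a b :=
    (((continuous_pow _).continuousOn).smul (hDc.mono fun ρ hρ => ha.trans_le hρ.1)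
      |>.intervalIntegrable_of_Icc hab)
  have hi2 : IntervalIntegrable (fun ρ : ℝ => (((d - 1 : ℕ) : ℝ) * ρ ^ (d - 1 - 1)) • S ρ) volume a b :=
    ((continuous_const.mul (continuous_pow _)).continuousOn.smul hSc.continuousOn
      |>.intervalIntegrable_of_Icc hab)
  rw [intervalIntegral.integral_add hi1 hi2] at hftc
  -- the two shell integrals in polar coordinates
  have hK : IsCompact {x : E | a ≤ ‖x‖ ∧ ‖x‖ ≤ b} := by
    have : {x : E | a ≤ ‖x‖ ∧ ‖x‖ ≤ b} ⊆ closedBall 0 b := fun x hx => by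
      rw [mem_closedBall, dist_zero_right]; exact hx.2
    exact (isCompact_closedBall 0 b).of_isClosed_subset
      ((isClosed_le continuous_const continuous_norm).inter
        (isClosed_le continuous_norm continuous_const)) this
  have hK0 : {x : E | a ≤ ‖x‖ ∧ ‖x‖ ≤ b} ⊆ {0}ᶜ := fun x hx h0 => by
    rw [mem_singleton_iff] at h0
    have h1 : a ≤ ‖x‖ := hx.1
    rw [h0, norm_zero] at h1
    linarith
  have hsub : {x : E | a < ‖x‖ ∧ ‖x‖ < b} ⊆ {x : E | a ≤ ‖x‖ ∧ ‖x‖ ≤ b} := fun x hx =>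
    ⟨hx.1.le, hx.2.le⟩
  have hI1 : IntegrableOn (fun x => fderiv ℝ f x (‖x‖⁻¹ • x)) {x : E | a < ‖x‖ ∧ ‖x‖ < b} μ :=
    (((continuousOn_radialDeriv hf).mono hK0).integrableOn_compact hK).mono_set hsub
  have hI2 : IntegrableOn (fun x => ‖x‖⁻¹ • f x) {x : E | a < ‖x‖ ∧ ‖x‖ < b} μ := by
    refine (ContinuousOn.integrableOn_compact hK ?_).mono_set hsub
    exact ((continuousOn_inv₀.comp continuous_norm.continuousOn fun x hx => by
      have := hK0 hx; simpa using this).smul hf.continuous.continuousOn)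
  rw [setIntegral_shell_eq_integral_sphereIntegral μ hI1 ha.le,
    setIntegral_shell_eq_integral_sphereIntegral μ hI2 ha.le]
  -- identify with the interval integrals of the FTC
  have e1 : ∫ ρ in Ioo a b, ρ ^ (d - 1) • D ρ = ∫ ρ in a..b, ρ ^ (d - 1) • D ρ := by
    rw [intervalIntegral.integral_of_le hab, integral_Ioc_eq_integral_Ioo]
  have e2 : ((d - 1 : ℕ) : ℝ) • ∫ ρ in Ioo a b, ρ ^ (d - 1) • sphereIntegral μ (fun x => ‖x‖⁻¹ • f x) ρ =
      ∫ ρ in a..b, (((d - 1 : ℕ) : ℝ) * ρ ^ (d - 1 - 1)) • S ρ := by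
    rw [intervalIntegral.integral_of_le hab, integral_Ioc_eq_integral_Ioo, ← integral_smul]
    refine setIntegral_congr_fun measurableSet_Ioo fun ρ hρ => ?_
    have hρ0 : 0 < ρ := ha.trans hρ.1
    rw [sphereIntegral_inv_norm_smul μ hρ0, smul_smul, smul_smul]
    congr 1
    -- `↑(d-1) * (ρ^(d-1) * ρ⁻¹) = ↑(d-1) * ρ^(d-1-1)`
    rcases Nat.exists_eq_add_of_le hd1 with ⟨n, hn⟩
    rw [hn]
    rcases n with _ | n
    · simp
    · simp only [Nat.add_sub_cancel_left, Nat.add_sub_cancel]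
      rw [pow_succ, mul_assoc, mul_inv_cancel_right₀ hρ0.ne']
  rw [e1, e2]
  -- conclude from the FTC: `∫ G' = G b - G a`
  have hsum : (∫ ρ in a..b, ρ ^ (d - 1) • D ρ) =
      (b ^ (d - 1) • S b - a ^ (d - 1) • S a) - ∫ ρ in a..b, (((d - 1 : ℕ) : ℝ) * ρ ^ (d - 1 - 1)) • S ρ := by
    rw [eq_sub_iff_add_eq, hftc]
  rw [hsum]

end Literature.Analysis.FluidPDE

end
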